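import Summits.HodgeConjecture.HodgeConjecture.Theorems.F0P6aCanonicalTwistIdealAsTypeNorm    -- ★ p848087 organ #4 (LA4-p03 (g0)): rows (a)(b)(c)(FROB-𝔞) of `𝔞_can` as a type product (over ★ p847929)
import Summits.HodgeConjecture.HodgeConjecture.Theorems.F0P6aCanonicalFrobeniusIdealCounts     -- ★ p847936 (LA3-p03): `hone_of_banal`; re-exports ★ p847883 `F0P6aCanonicalFrobeniusIdealRows` ((ρ1) = (π1))
import Summits.HodgeConjecture.HodgeConjecture.Theorems.F0P6aCanonicalTwistIdealIndep         -- ★ p848753 organ #5 (LA4-p04 (g0)): `canonicalTwistIdeal_indep` ((FROB-can) for every `(σ₀, τR)`)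
import HarnessLib

/-!
# Crux `HLiu418` — P6 sub-line **F0-P6a**, organ «ARITH-can»: the WITNESS-INDEPENDENT ARITHMETIC ROWS of `ETwistKerAt` at `twistIdeal := 𝔞_can(m, τR, w)`, `twistNorm := p ^ f`

Cell `hodgecm-mathlib` (D-0151), crux `stmt-HodgeConjecture-24832` (hLiu418), `--supports` only (count-neutral).  «L4» LA4-plan (g0) DEAL #17 (2026-09-02T04:51:58Z)
→ LA4-p04 (g2).  THEOREMS ONLY (no definition, no instance, no notation, no named fact, no `sorry`); no `Cruxes/…/Lines` import, so the Kottwitz signature `m`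
is ABSTRACT (the consumer instantiates `m := fun τ => mOf ι₁ Φ (σ₀.comp τ)`).

THE POINT.  The E-READINGS leaf ED. 2 letter `ETwistKerAt S Kc w e E pChar fDeg` (tree `Lines/F0_P6a_EReadings.lean` :546) asks, for the twist datum
`(twistIdeal γ, twistNorm γ)` of the E-witness, seven IDEAL ROWS — (a) `(twistNorm γ) = twistIdeal γ · c • twistIdeal γ`, (b) `twistIdeal γ + (E.N) = (1)`,
(c) `twistIdeal γ ≠ 0`, and at a Frobenius reading `γ = γ_σ`: (FROB-𝔞) `𝔭_w ∣ twistIdeal γ`, (FROB-n) `twistNorm γ = p ^ f`, (π1) `twistIdeal γ + 𝔭_{c•w} = (1)`,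
(FROB-can) `twistIdeal γ = 𝔞_can(mOf ι₁ Φ (σ₀ ∘ ·), τR, w)` for EVERY complex embedding `σ₀` of `F̄_w` over `ι₁` and EVERY restriction family `τR` — and two
GEOMETRIC rows (K-law)∕(cover).  With the Shimura–Taniyama choice `twistIdeal γ_σ := 𝔞_can(m, τR, w)`, `twistNorm γ_σ := p ^ f` the seven ideal rows are PURE
NUMBER THEORY and every one of them is ALREADY ★ at the token
`𝔞_can(m, τR, w) = ∏ τ ∈ univ.filter (m τ ≠ 0 ∧ ker (residue ∘ τR τ) ≠ 𝔭_{c•w}), ker (residue ∘ τR τ)` (★ p847883): organ #4 ★ p848087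
`exists_canonicalTwistIdeal_rows` ((a)(b)(c)(FROB-𝔞)), ★ p847883 `prod_filter_ker_sup_complexConj_smul_eq_top` ((π1) = (ρ1)), organ #5 ★ p848753
`canonicalTwistIdeal_indep` ((FROB-can) for all `(σ₀, τR)`), (FROB-n) `rfl`.  THIS FILE IS THE ZIP: ONE CALL delivering the rows in the LETTER՚S ORDER AND
TOKENS (`twistIdeal γ ↦ 𝔞_can`, `twistNorm γ ↦ p ^ f`, `E.N ↦ N`), with the hypotheses in the KOTTWITZ-ROW CURRENCY of the P-line (`PELKottLawAt` ∕ §0c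
`kottRows_explicit`: `m_pair`, `m_count`, `m_banal` — NOT `hone`, which ★ `hone_of_banal` derives; `m_unmixed` is not needed by any arithmetic row) and the level
guard either as the letter guard `¬ p ∣ N` or as GEN՚s place-avoidance `(N : 𝓞 F) ∉ 𝔭_w` (⇒ `¬ p ∣ N` since `p ∈ 𝔭_w`; cf. ★ `QuasiInverseSpreadStage.coprime_of_natCast_mem_of_natCast_not_mem`,
and ★ `finite_setOf_natCast_mem_asIdeal` for the finiteness of the excluded level places — CITED, not restated).

MAIN STATEMENTS.  §1 **`canonicalTwistIdeal_eLetterRows`** (HEAD-m: the five rows (a)(b)(c)(FROB-𝔞)(π1) at `𝔞_can(m, τR, w)`, `p ^ f`, `N`) and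
`canonicalTwistIdeal_eLetterRows_of_not_mem` (place-avoidance guard); §2 **`canonicalTwistIdeal_eLetterRows_sigma`** (HEAD-σ: the same for the composed
signature `m := M ∘ (σ₁ ∘ ·)` of ANY signature function `M` on the `L`-valued embeddings, PLUS (FROB-can-∀)
`∀ σ₀ over ι₁, ∀ τR with τR_spec, 𝔞_can(M ∘ (σ₁ ∘ ·), τR₁, w) = 𝔞_can(M ∘ (σ₀ ∘ ·), τR, w)` — the consumer takes `L := ℂ`, `M := mOf ι₁ (Φf i)`: the six
non-geometric rows of `ETwistKerAt` at a Frobenius reading, leaving EXACTLY (K-law)∕(cover) to the E-side geometry) and its `_of_not_mem` variant.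

USE (GEN `stub_GEN` ∕ E-line ED. 6 `twist` export, per good split `w ∉ S_G` and chosen index `i`): pick `σ₁ : F̄_w →+* ℂ` over `ι₁` (★ p847344
`exists_ringHom_comp_eq`) and `τR₁` (★ p847313 `exists_restrict`); the three KOTT rows of `m₁ := mOf ι₁ (Φf i) (σ₁ ∘ ·)` are P-LINE §0b
`mOf_comp_add_mOf_comp_complexConj_eq_two` ∕ `mOf_comp_eq_zero_or_two_of_ker_ne` and ★ p847313 `sum_filter_ker_residue_restrict_eq_one` under `KottAdaptedAt`
(the §0c `kottRows_explicit` computation with `T.Φ ↦ Φf i`); then `canonicalTwistIdeal_eLetterRows_sigma … hp hpw hf hN` is rows (a)(b)(c)(FROB-𝔞)(π1)(FROB-can)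
of `ETwistKerAt … (Ef i) pChar fDeg` at `twistIdeal γ_σ := 𝔞_can(m₁, τR₁, w)`, `twistNorm γ_σ := pChar ^ fDeg`.

HC_CM is proved only modulo the 7 printed citations (2 remaining named inputs hLiu418 24832, h413 24833) until rung 0 closes; nothing here changes a count.
[cite: Shimura1998, §8.3 Prop. 29; §13.1 Theorem 1 (pp. 97–99) and (7)] [cite: RapoportSmithlingZhang2020Diagonal, §4.1 (4.6) p. 16 and p. 17; §3.2 (3.8) p. 11]
[cite: NeukirchANT1999, Ch. I §8 Prop. (8.3); Ch. III §1 (1.6) Prop. (iv)]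
-/

set_option autoImplicit false
set_option linter.dupNamespace false  -- `Summit.HodgeConjecture.HodgeConjecture.…` BY DESIGN (D-0017)

noncomputable section

open NumberField IsDedekindDomain IsLocalRing
open scoped Pointwise
open Literature.NumberTheory.GaloisRepresentations (closureValuationSubring)
open Literature.NumberTheory.Automorphic
open Summit.HodgeConjecture.HodgeConjecture.Theorems.F0P6aCanonicalTwistIdealAsTypeNorm (exists_canonicalTwistIdeal_rows)
open Summit.HodgeConjecture.HodgeConjecture.Theorems.F0P6aCanonicalFrobeniusIdealRows (prod_filter_ker_sup_complexConj_smul_eq_top)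
open Summit.HodgeConjecture.HodgeConjecture.Theorems.F0P6aCanonicalFrobeniusIdealCounts (hone_of_banal)
open Summit.HodgeConjecture.HodgeConjecture.Theorems.F0P6aCanonicalTwistIdealIndep (canonicalTwistIdeal_indep)

namespace Summit.HodgeConjecture.HodgeConjecture.Theorems.F0P6aCanonicalTwistIdealArithRows

variable {F : Type} [Field F] [NumberField F] [IsCMField F] (w : HeightOneSpectrum (𝓞 F))

omit [NumberField F] [IsCMField F] in
/-- `p ∈ 𝔭_w` and `N ∉ 𝔭_w` ⇒ `p ∤ N` (GEN՚s place-avoidance ⇒ the letter guard; the `Coprime` spelling is ★ `coprime_of_natCast_mem_of_natCast_not_mem`).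
[cite: NeukirchANT1999, Ch. I §8 Prop. (8.3)] -/
theorem not_dvd_of_natCast_mem_of_natCast_not_mem {p N : ℕ} (hpw : (p : 𝓞 F) ∈ w.asIdeal) (hNw : ((N : ℕ) : 𝓞 F) ∉ w.asIdeal) :
    ¬ p ∣ N := by
  rintro ⟨k, rfl⟩
  exact hNw (by rw [Nat.cast_mul]; exact w.asIdeal.mul_mem_right _ hpw)

/-! ### §1 HEAD-m: the five arithmetic rows of `ETwistKerAt` at `(𝔞_can(m, τR, w), p ^ f)` under the Kottwitz rows of `m` -/

section Signature

variable (τR : (F →+* AlgebraicClosure (w.adicCompletion F)) → (𝓞 F →+* ↥(closureValuationSubring (w.adicCompletion F))))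
  (hτR : ∀ (τ : F →+* AlgebraicClosure (w.adicCompletion F)) (x : 𝓞 F),
    ((τR τ x : ↥(closureValuationSubring (w.adicCompletion F))) : AlgebraicClosure (w.adicCompletion F)) = τ (x : F))
  (m : (F →+* AlgebraicClosure (w.adicCompletion F)) → ℕ)
  (hpair : ∀ τ : F →+* AlgebraicClosure (w.adicCompletion F),
    m τ + m (τ.comp ((IsCMField.complexConj F : F ≃ₐ[↥(maximalRealSubfield F)] F) : F →+* F)) = 2)
  (hcount : ∑ τ ∈ (Finset.univ.filter fun τ : F →+* AlgebraicClosure (w.adicCompletion F) =>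
      RingHom.ker ((residue ↥(closureValuationSubring (w.adicCompletion F))).comp (τR τ)) =
        (((IsCMField.complexConj F) • w).asIdeal : Ideal (𝓞 F))), m τ = 1)
  (hbanal : ∀ τ : F →+* AlgebraicClosure (w.adicCompletion F),
    RingHom.ker ((residue ↥(closureValuationSubring (w.adicCompletion F))).comp (τR τ)) ≠ (w.asIdeal : Ideal (𝓞 F)) →
    RingHom.ker ((residue ↥(closureValuationSubring (w.adicCompletion F))).comp (τR τ)) ≠
      (((IsCMField.complexConj F) • w).asIdeal : Ideal (𝓞 F)) →
    m τ = 0 ∨ m τ = 2)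

include hτR hpair hcount hbanal in
/-- **HEAD-m «ARITH-can» — THE FIVE WITNESS-INDEPENDENT ROWS OF `ETwistKerAt` AT `twistIdeal := 𝔞_can(m, τR, w)`, `twistNorm := p ^ f`**, in the letter՚s order
and tokens: (a) `Ideal.span {((p ^ f : ℕ) : 𝓞 F)} = 𝔞_can * c • 𝔞_can`, (b) `𝔞_can ⊔ Ideal.span {((N : ℕ) : 𝓞 F)} = ⊤`, (c) `𝔞_can ≠ ⊥`, (FROB-𝔞) `w.asIdeal ∣ 𝔞_can`,
(π1) `𝔞_can ⊔ 𝔭_{c•w} = ⊤` — under the KOTTWITZ ROWS of `m` in the P-line currency (`m_pair`, `m_count`, `m_banal`), `F ∕ ℚ` Galois, `c•w ≠ w`, and the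
arithmetic of `w` (`p` prime, `p ∈ 𝔭_w`, `N𝔭_{c•w} = p ^ f`, `p ∤ N`).  ZIP of ★ organ #4 `exists_canonicalTwistIdeal_rows` + ★ (ρ1) `prod_filter_ker_sup_complexConj_smul_eq_top`
through ★ `hone_of_banal`. [cite: Shimura1998, §8.3 Prop. 29; §13.1 Theorem 1 (pp. 97–99) and (7)] [cite: RapoportSmithlingZhang2020Diagonal, §4.1 (4.6) p. 16 and p. 17] -/
theorem canonicalTwistIdeal_eLetterRows [IsGalois ℚ F] (hw : (IsCMField.complexConj F) • w ≠ w)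
    {p f : ℕ} (hp : p.Prime) (hpw : (p : 𝓞 F) ∈ w.asIdeal) (hf : Nat.card (𝓞 F ⧸ ((IsCMField.complexConj F) • w).asIdeal) = p ^ f)
    {N : ℕ} (hN : ¬ p ∣ N) :
    Ideal.span {((p ^ f : ℕ) : 𝓞 F)} =
      (∏ τ ∈ Finset.univ.filter (fun τ : F →+* AlgebraicClosure (w.adicCompletion F) =>
          m τ ≠ 0 ∧ RingHom.ker ((residue ↥(closureValuationSubring (w.adicCompletion F))).comp (τR τ)) ≠
            (((IsCMField.complexConj F) • w).asIdeal : Ideal (𝓞 F))),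
        RingHom.ker ((residue ↥(closureValuationSubring (w.adicCompletion F))).comp (τR τ))) *
      (IsCMField.complexConj F) •
        (∏ τ ∈ Finset.univ.filter (fun τ : F →+* AlgebraicClosure (w.adicCompletion F) =>
          m τ ≠ 0 ∧ RingHom.ker ((residue ↥(closureValuationSubring (w.adicCompletion F))).comp (τR τ)) ≠
            (((IsCMField.complexConj F) • w).asIdeal : Ideal (𝓞 F))),
        RingHom.ker ((residue ↥(closureValuationSubring (w.adicCompletion F))).comp (τR τ))) ∧
    (∏ τ ∈ Finset.univ.filter (fun τ : F →+* AlgebraicClosure (w.adicCompletion F) =>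
          m τ ≠ 0 ∧ RingHom.ker ((residue ↥(closureValuationSubring (w.adicCompletion F))).comp (τR τ)) ≠
            (((IsCMField.complexConj F) • w).asIdeal : Ideal (𝓞 F))),
        RingHom.ker ((residue ↥(closureValuationSubring (w.adicCompletion F))).comp (τR τ))) ⊔
      Ideal.span {((N : ℕ) : 𝓞 F)} = ⊤ ∧
    (∏ τ ∈ Finset.univ.filter (fun τ : F →+* AlgebraicClosure (w.adicCompletion F) =>
          m τ ≠ 0 ∧ RingHom.ker ((residue ↥(closureValuationSubring (w.adicCompletion F))).comp (τR τ)) ≠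
            (((IsCMField.complexConj F) • w).asIdeal : Ideal (𝓞 F))),
        RingHom.ker ((residue ↥(closureValuationSubring (w.adicCompletion F))).comp (τR τ))) ≠ ⊥ ∧
    w.asIdeal ∣
      (∏ τ ∈ Finset.univ.filter (fun τ : F →+* AlgebraicClosure (w.adicCompletion F) =>
          m τ ≠ 0 ∧ RingHom.ker ((residue ↥(closureValuationSubring (w.adicCompletion F))).comp (τR τ)) ≠
            (((IsCMField.complexConj F) • w).asIdeal : Ideal (𝓞 F))),
        RingHom.ker ((residue ↥(closureValuationSubring (w.adicCompletion F))).comp (τR τ))) ∧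
    (∏ τ ∈ Finset.univ.filter (fun τ : F →+* AlgebraicClosure (w.adicCompletion F) =>
          m τ ≠ 0 ∧ RingHom.ker ((residue ↥(closureValuationSubring (w.adicCompletion F))).comp (τR τ)) ≠
            (((IsCMField.complexConj F) • w).asIdeal : Ideal (𝓞 F))),
        RingHom.ker ((residue ↥(closureValuationSubring (w.adicCompletion F))).comp (τR τ))) ⊔
      (((IsCMField.complexConj F) • w).asIdeal : Ideal (𝓞 F)) = ⊤ := by
  have hone := hone_of_banal w τR m hbanal
  obtain ⟨𝔞, rfl, ha, hb, hc, hfrob⟩ := exists_canonicalTwistIdeal_rows w τR hτR m hpair hcount hone hw hp hpw hf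
  exact ⟨ha, hb N hN, hc, hfrob, prod_filter_ker_sup_complexConj_smul_eq_top w τR hτR m hpair hcount hone hw⟩

include hτR hpair hcount hbanal in
/-- **HEAD-m under GEN՚s PLACE-AVOIDANCE GUARD**: as `canonicalTwistIdeal_eLetterRows`, with the letter guard `p ∤ N` replaced by `(N : 𝓞 F) ∉ 𝔭_w` (the level
places go into GEN՚s finite `S_G`, ★ `finite_setOf_natCast_mem_asIdeal`; `p ∈ 𝔭_w` then forces `p ∤ N`).
[cite: Shimura1998, §13.1 Theorem 1 (pp. 97–99) and (7)] [cite: RapoportSmithlingZhang2020Diagonal, §4.1 (4.6) p. 16 and p. 17] [cite: NeukirchANT1999, Ch. I §8 Prop. (8.3)] -/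
theorem canonicalTwistIdeal_eLetterRows_of_not_mem [IsGalois ℚ F] (hw : (IsCMField.complexConj F) • w ≠ w)
    {p f : ℕ} (hp : p.Prime) (hpw : (p : 𝓞 F) ∈ w.asIdeal) (hf : Nat.card (𝓞 F ⧸ ((IsCMField.complexConj F) • w).asIdeal) = p ^ f)
    {N : ℕ} (hNw : ((N : ℕ) : 𝓞 F) ∉ w.asIdeal) :
    Ideal.span {((p ^ f : ℕ) : 𝓞 F)} =
      (∏ τ ∈ Finset.univ.filter (fun τ : F →+* AlgebraicClosure (w.adicCompletion F) =>
          m τ ≠ 0 ∧ RingHom.ker ((residue ↥(closureValuationSubring (w.adicCompletion F))).comp (τR τ)) ≠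
            (((IsCMField.complexConj F) • w).asIdeal : Ideal (𝓞 F))),
        RingHom.ker ((residue ↥(closureValuationSubring (w.adicCompletion F))).comp (τR τ))) *
      (IsCMField.complexConj F) •
        (∏ τ ∈ Finset.univ.filter (fun τ : F →+* AlgebraicClosure (w.adicCompletion F) =>
          m τ ≠ 0 ∧ RingHom.ker ((residue ↥(closureValuationSubring (w.adicCompletion F))).comp (τR τ)) ≠
            (((IsCMField.complexConj F) • w).asIdeal : Ideal (𝓞 F))),
        RingHom.ker ((residue ↥(closureValuationSubring (w.adicCompletion F))).comp (τR τ))) ∧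
    (∏ τ ∈ Finset.univ.filter (fun τ : F →+* AlgebraicClosure (w.adicCompletion F) =>
          m τ ≠ 0 ∧ RingHom.ker ((residue ↥(closureValuationSubring (w.adicCompletion F))).comp (τR τ)) ≠
            (((IsCMField.complexConj F) • w).asIdeal : Ideal (𝓞 F))),
        RingHom.ker ((residue ↥(closureValuationSubring (w.adicCompletion F))).comp (τR τ))) ⊔
      Ideal.span {((N : ℕ) : 𝓞 F)} = ⊤ ∧
    (∏ τ ∈ Finset.univ.filter (fun τ : F →+* AlgebraicClosure (w.adicCompletion F) =>
          m τ ≠ 0 ∧ RingHom.ker ((residue ↥(closureValuationSubring (w.adicCompletion F))).comp (τR τ)) ≠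
            (((IsCMField.complexConj F) • w).asIdeal : Ideal (𝓞 F))),
        RingHom.ker ((residue ↥(closureValuationSubring (w.adicCompletion F))).comp (τR τ))) ≠ ⊥ ∧
    w.asIdeal ∣
      (∏ τ ∈ Finset.univ.filter (fun τ : F →+* AlgebraicClosure (w.adicCompletion F) =>
          m τ ≠ 0 ∧ RingHom.ker ((residue ↥(closureValuationSubring (w.adicCompletion F))).comp (τR τ)) ≠
            (((IsCMField.complexConj F) • w).asIdeal : Ideal (𝓞 F))),
        RingHom.ker ((residue ↥(closureValuationSubring (w.adicCompletion F))).comp (τR τ))) ∧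
    (∏ τ ∈ Finset.univ.filter (fun τ : F →+* AlgebraicClosure (w.adicCompletion F) =>
          m τ ≠ 0 ∧ RingHom.ker ((residue ↥(closureValuationSubring (w.adicCompletion F))).comp (τR τ)) ≠
            (((IsCMField.complexConj F) • w).asIdeal : Ideal (𝓞 F))),
        RingHom.ker ((residue ↥(closureValuationSubring (w.adicCompletion F))).comp (τR τ))) ⊔
      (((IsCMField.complexConj F) • w).asIdeal : Ideal (𝓞 F)) = ⊤ :=
  canonicalTwistIdeal_eLetterRows w τR hτR m hpair hcount hbanal hw hp hpw hf (not_dvd_of_natCast_mem_of_natCast_not_mem w hpw hNw)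

end Signature

/-! ### §2 HEAD-σ: the composed signature `m := M ∘ (σ₁ ∘ ·)` and the (FROB-can) row for EVERY `(σ₀, τR)` -/

section Sigma

variable {L : Type} [Field L] (ι₁ : F →+* L) (M : (F →+* L) → ℕ)
  (σ₁ : AlgebraicClosure (w.adicCompletion F) →+* L)
  (hσ₁ : σ₁.comp (algebraMap F (AlgebraicClosure (w.adicCompletion F))) = ι₁)
  (τR₁ : (F →+* AlgebraicClosure (w.adicCompletion F)) → (𝓞 F →+* ↥(closureValuationSubring (w.adicCompletion F))))
  (hτR₁ : ∀ (τ : F →+* AlgebraicClosure (w.adicCompletion F)) (x : 𝓞 F),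
    ((τR₁ τ x : ↥(closureValuationSubring (w.adicCompletion F))) : AlgebraicClosure (w.adicCompletion F)) = τ (x : F))
  (hpair : ∀ τ : F →+* AlgebraicClosure (w.adicCompletion F),
    M (σ₁.comp τ) + M (σ₁.comp (τ.comp ((IsCMField.complexConj F : F ≃ₐ[↥(maximalRealSubfield F)] F) : F →+* F))) = 2)
  (hcount : ∑ τ ∈ (Finset.univ.filter fun τ : F →+* AlgebraicClosure (w.adicCompletion F) =>
      RingHom.ker ((residue ↥(closureValuationSubring (w.adicCompletion F))).comp (τR₁ τ)) =
        (((IsCMField.complexConj F) • w).asIdeal : Ideal (𝓞 F))), M (σ₁.comp τ) = 1)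
  (hbanal : ∀ τ : F →+* AlgebraicClosure (w.adicCompletion F),
    RingHom.ker ((residue ↥(closureValuationSubring (w.adicCompletion F))).comp (τR₁ τ)) ≠ (w.asIdeal : Ideal (𝓞 F)) →
    RingHom.ker ((residue ↥(closureValuationSubring (w.adicCompletion F))).comp (τR₁ τ)) ≠
      (((IsCMField.complexConj F) • w).asIdeal : Ideal (𝓞 F)) →
    M (σ₁.comp τ) = 0 ∨ M (σ₁.comp τ) = 2)

include hσ₁ hτR₁ hpair hcount hbanal in
/-- **HEAD-σ «ARITH-can» — THE SIX NON-GEOMETRIC ROWS OF `ETwistKerAt` AT A FROBENIUS READING**, for the E-payer՚s FIXED choice `(σ₁, τR₁)` and composed signature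
`m₁ := M ∘ (σ₁ ∘ ·)` (consumer: `L := ℂ`, `M := mOf ι₁ (Φf i)`): (a)(b)(c)(FROB-𝔞)(π1) at `twistIdeal := 𝔞_can(m₁, τR₁, w)`, `twistNorm := p ^ f` (HEAD-m) AND
(FROB-can-∀) `∀ σ₀` over `ι₁`, `∀ τR` with `τR_spec`: `𝔞_can(m₁, τR₁, w) = 𝔞_can(M ∘ (σ₀ ∘ ·), τR, w)` — the letter՚s (FROB-can) row after the substitution
`twistIdeal γ_σ := 𝔞_can(m₁, τR₁, w)` (★ organ #5 `canonicalTwistIdeal_indep`: the restriction family is unique and `σ₀ ∘ τ = σ₁ ∘ τ` on `F`-embeddings for `F ∕ ℚ`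
Galois).  What is left of `ETwistKerAt` at `γ_σ` is exactly (K-law)∕(cover) — E-side geometry. [cite: Shimura1998, §8.3 Prop. 29; §13.1 Theorem 1 (pp. 97–99) and (7)]
[cite: RapoportSmithlingZhang2020Diagonal, §4.1 (4.6) p. 16 and p. 17; Remark 3.6 (i) (3.14) p. 13] -/
theorem canonicalTwistIdeal_eLetterRows_sigma [IsGalois ℚ F] (hw : (IsCMField.complexConj F) • w ≠ w)
    {p f : ℕ} (hp : p.Prime) (hpw : (p : 𝓞 F) ∈ w.asIdeal) (hf : Nat.card (𝓞 F ⧸ ((IsCMField.complexConj F) • w).asIdeal) = p ^ f)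
    {N : ℕ} (hN : ¬ p ∣ N) :
    (Ideal.span {((p ^ f : ℕ) : 𝓞 F)} =
      (∏ τ ∈ Finset.univ.filter (fun τ : F →+* AlgebraicClosure (w.adicCompletion F) =>
          M (σ₁.comp τ) ≠ 0 ∧ RingHom.ker ((residue ↥(closureValuationSubring (w.adicCompletion F))).comp (τR₁ τ)) ≠
            (((IsCMField.complexConj F) • w).asIdeal : Ideal (𝓞 F))),
        RingHom.ker ((residue ↥(closureValuationSubring (w.adicCompletion F))).comp (τR₁ τ))) *
      (IsCMField.complexConj F) •
        (∏ τ ∈ Finset.univ.filter (fun τ : F →+* AlgebraicClosure (w.adicCompletion F) =>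
          M (σ₁.comp τ) ≠ 0 ∧ RingHom.ker ((residue ↥(closureValuationSubring (w.adicCompletion F))).comp (τR₁ τ)) ≠
            (((IsCMField.complexConj F) • w).asIdeal : Ideal (𝓞 F))),
        RingHom.ker ((residue ↥(closureValuationSubring (w.adicCompletion F))).comp (τR₁ τ))) ∧
    (∏ τ ∈ Finset.univ.filter (fun τ : F →+* AlgebraicClosure (w.adicCompletion F) =>
          M (σ₁.comp τ) ≠ 0 ∧ RingHom.ker ((residue ↥(closureValuationSubring (w.adicCompletion F))).comp (τR₁ τ)) ≠
            (((IsCMField.complexConj F) • w).asIdeal : Ideal (𝓞 F))),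
        RingHom.ker ((residue ↥(closureValuationSubring (w.adicCompletion F))).comp (τR₁ τ))) ⊔
      Ideal.span {((N : ℕ) : 𝓞 F)} = ⊤ ∧
    (∏ τ ∈ Finset.univ.filter (fun τ : F →+* AlgebraicClosure (w.adicCompletion F) =>
          M (σ₁.comp τ) ≠ 0 ∧ RingHom.ker ((residue ↥(closureValuationSubring (w.adicCompletion F))).comp (τR₁ τ)) ≠
            (((IsCMField.complexConj F) • w).asIdeal : Ideal (𝓞 F))),
        RingHom.ker ((residue ↥(closureValuationSubring (w.adicCompletion F))).comp (τR₁ τ))) ≠ ⊥ ∧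
    w.asIdeal ∣
      (∏ τ ∈ Finset.univ.filter (fun τ : F →+* AlgebraicClosure (w.adicCompletion F) =>
          M (σ₁.comp τ) ≠ 0 ∧ RingHom.ker ((residue ↥(closureValuationSubring (w.adicCompletion F))).comp (τR₁ τ)) ≠
            (((IsCMField.complexConj F) • w).asIdeal : Ideal (𝓞 F))),
        RingHom.ker ((residue ↥(closureValuationSubring (w.adicCompletion F))).comp (τR₁ τ))) ∧
    (∏ τ ∈ Finset.univ.filter (fun τ : F →+* AlgebraicClosure (w.adicCompletion F) =>
          M (σ₁.comp τ) ≠ 0 ∧ RingHom.ker ((residue ↥(closureValuationSubring (w.adicCompletion F))).comp (τR₁ τ)) ≠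
            (((IsCMField.complexConj F) • w).asIdeal : Ideal (𝓞 F))),
        RingHom.ker ((residue ↥(closureValuationSubring (w.adicCompletion F))).comp (τR₁ τ))) ⊔
      (((IsCMField.complexConj F) • w).asIdeal : Ideal (𝓞 F)) = ⊤) ∧
    ∀ (σ₀ : AlgebraicClosure (w.adicCompletion F) →+* L), σ₀.comp (algebraMap F (AlgebraicClosure (w.adicCompletion F))) = ι₁ →
      ∀ (τR : (F →+* AlgebraicClosure (w.adicCompletion F)) → (𝓞 F →+* ↥(closureValuationSubring (w.adicCompletion F)))),
        (∀ (τ : F →+* AlgebraicClosure (w.adicCompletion F)) (x : 𝓞 F),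
          ((τR τ x : ↥(closureValuationSubring (w.adicCompletion F))) : AlgebraicClosure (w.adicCompletion F)) = τ (x : F)) →
      (∏ τ ∈ Finset.univ.filter (fun τ : F →+* AlgebraicClosure (w.adicCompletion F) =>
          M (σ₁.comp τ) ≠ 0 ∧ RingHom.ker ((residue ↥(closureValuationSubring (w.adicCompletion F))).comp (τR₁ τ)) ≠
            (((IsCMField.complexConj F) • w).asIdeal : Ideal (𝓞 F))),
        RingHom.ker ((residue ↥(closureValuationSubring (w.adicCompletion F))).comp (τR₁ τ))) =
      ∏ τ ∈ Finset.univ.filter (fun τ : F →+* AlgebraicClosure (w.adicCompletion F) =>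
          M (σ₀.comp τ) ≠ 0 ∧ RingHom.ker ((residue ↥(closureValuationSubring (w.adicCompletion F))).comp (τR τ)) ≠
            (((IsCMField.complexConj F) • w).asIdeal : Ideal (𝓞 F))),
        RingHom.ker ((residue ↥(closureValuationSubring (w.adicCompletion F))).comp (τR τ)) :=
  ⟨canonicalTwistIdeal_eLetterRows w τR₁ hτR₁ (fun τ => M (σ₁.comp τ)) hpair hcount hbanal hw hp hpw hf hN,
    fun σ₀ hσ₀ τR hτR =>
      canonicalTwistIdeal_indep w ι₁ M (((IsCMField.complexConj F) • w).asIdeal : Ideal (𝓞 F)) σ₁ σ₀ hσ₁ hσ₀ τR₁ τR hτR₁ hτR⟩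

include hσ₁ hτR₁ hpair hcount hbanal in
/-- **HEAD-σ under GEN՚s PLACE-AVOIDANCE GUARD** (`(N : 𝓞 F) ∉ 𝔭_w` in place of `p ∤ N`; cf. `canonicalTwistIdeal_eLetterRows_of_not_mem`).
[cite: Shimura1998, §13.1 Theorem 1 (pp. 97–99) and (7)] [cite: RapoportSmithlingZhang2020Diagonal, §4.1 (4.6) p. 16 and p. 17] [cite: NeukirchANT1999, Ch. I §8 Prop. (8.3)] -/
theorem canonicalTwistIdeal_eLetterRows_sigma_of_not_mem [IsGalois ℚ F] (hw : (IsCMField.complexConj F) • w ≠ w)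
    {p f : ℕ} (hp : p.Prime) (hpw : (p : 𝓞 F) ∈ w.asIdeal) (hf : Nat.card (𝓞 F ⧸ ((IsCMField.complexConj F) • w).asIdeal) = p ^ f)
    {N : ℕ} (hNw : ((N : ℕ) : 𝓞 F) ∉ w.asIdeal) :
    (Ideal.span {((p ^ f : ℕ) : 𝓞 F)} =
      (∏ τ ∈ Finset.univ.filter (fun τ : F →+* AlgebraicClosure (w.adicCompletion F) =>
          M (σ₁.comp τ) ≠ 0 ∧ RingHom.ker ((residue ↥(closureValuationSubring (w.adicCompletion F))).comp (τR₁ τ)) ≠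
            (((IsCMField.complexConj F) • w).asIdeal : Ideal (𝓞 F))),
        RingHom.ker ((residue ↥(closureValuationSubring (w.adicCompletion F))).comp (τR₁ τ))) *
      (IsCMField.complexConj F) •
        (∏ τ ∈ Finset.univ.filter (fun τ : F →+* AlgebraicClosure (w.adicCompletion F) =>
          M (σ₁.comp τ) ≠ 0 ∧ RingHom.ker ((residue ↥(closureValuationSubring (w.adicCompletion F))).comp (τR₁ τ)) ≠
            (((IsCMField.complexConj F) • w).asIdeal : Ideal (𝓞 F))),
        RingHom.ker ((residue ↥(closureValuationSubring (w.adicCompletion F))).comp (τR₁ τ))) ∧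
    (∏ τ ∈ Finset.univ.filter (fun τ : F →+* AlgebraicClosure (w.adicCompletion F) =>
          M (σ₁.comp τ) ≠ 0 ∧ RingHom.ker ((residue ↥(closureValuationSubring (w.adicCompletion F))).comp (τR₁ τ)) ≠
            (((IsCMField.complexConj F) • w).asIdeal : Ideal (𝓞 F))),
        RingHom.ker ((residue ↥(closureValuationSubring (w.adicCompletion F))).comp (τR₁ τ))) ⊔
      Ideal.span {((N : ℕ) : 𝓞 F)} = ⊤ ∧
    (∏ τ ∈ Finset.univ.filter (fun τ : F →+* AlgebraicClosure (w.adicCompletion F) =>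
          M (σ₁.comp τ) ≠ 0 ∧ RingHom.ker ((residue ↥(closureValuationSubring (w.adicCompletion F))).comp (τR₁ τ)) ≠
            (((IsCMField.complexConj F) • w).asIdeal : Ideal (𝓞 F))),
        RingHom.ker ((residue ↥(closureValuationSubring (w.adicCompletion F))).comp (τR₁ τ))) ≠ ⊥ ∧
    w.asIdeal ∣
      (∏ τ ∈ Finset.univ.filter (fun τ : F →+* AlgebraicClosure (w.adicCompletion F) =>
          M (σ₁.comp τ) ≠ 0 ∧ RingHom.ker ((residue ↥(closureValuationSubring (w.adicCompletion F))).comp (τR₁ τ)) ≠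
            (((IsCMField.complexConj F) • w).asIdeal : Ideal (𝓞 F))),
        RingHom.ker ((residue ↥(closureValuationSubring (w.adicCompletion F))).comp (τR₁ τ))) ∧
    (∏ τ ∈ Finset.univ.filter (fun τ : F →+* AlgebraicClosure (w.adicCompletion F) =>
          M (σ₁.comp τ) ≠ 0 ∧ RingHom.ker ((residue ↥(closureValuationSubring (w.adicCompletion F))).comp (τR₁ τ)) ≠
            (((IsCMField.complexConj F) • w).asIdeal : Ideal (𝓞 F))),
        RingHom.ker ((residue ↥(closureValuationSubring (w.adicCompletion F))).comp (τR₁ τ))) ⊔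
      (((IsCMField.complexConj F) • w).asIdeal : Ideal (𝓞 F)) = ⊤) ∧
    ∀ (σ₀ : AlgebraicClosure (w.adicCompletion F) →+* L), σ₀.comp (algebraMap F (AlgebraicClosure (w.adicCompletion F))) = ι₁ →
      ∀ (τR : (F →+* AlgebraicClosure (w.adicCompletion F)) → (𝓞 F →+* ↥(closureValuationSubring (w.adicCompletion F)))),
        (∀ (τ : F →+* AlgebraicClosure (w.adicCompletion F)) (x : 𝓞 F),
          ((τR τ x : ↥(closureValuationSubring (w.adicCompletion F))) : AlgebraicClosure (w.adicCompletion F)) = τ (x : F)) →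
      (∏ τ ∈ Finset.univ.filter (fun τ : F →+* AlgebraicClosure (w.adicCompletion F) =>
          M (σ₁.comp τ) ≠ 0 ∧ RingHom.ker ((residue ↥(closureValuationSubring (w.adicCompletion F))).comp (τR₁ τ)) ≠
            (((IsCMField.complexConj F) • w).asIdeal : Ideal (𝓞 F))),
        RingHom.ker ((residue ↥(closureValuationSubring (w.adicCompletion F))).comp (τR₁ τ))) =
      ∏ τ ∈ Finset.univ.filter (fun τ : F →+* AlgebraicClosure (w.adicCompletion F) =>
          M (σ₀.comp τ) ≠ 0 ∧ RingHom.ker ((residue ↥(closureValuationSubring (w.adicCompletion F))).comp (τR τ)) ≠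
            (((IsCMField.complexConj F) • w).asIdeal : Ideal (𝓞 F))),
        RingHom.ker ((residue ↥(closureValuationSubring (w.adicCompletion F))).comp (τR τ)) :=
  canonicalTwistIdeal_eLetterRows_sigma w ι₁ M σ₁ hσ₁ τR₁ hτR₁ hpair hcount hbanal hw hp hpw hf
    (not_dvd_of_natCast_mem_of_natCast_not_mem w hpw hNw)

end Sigma

end Summit.HodgeConjecture.HodgeConjecture.Theorems.F0P6aCanonicalTwistIdealArithRows

end
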